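import Summits.ValiantsHypothesis.ValiantsHypothesis.Theorems.GrenetZeonDualUnipotentThreeHalvesHeavyTopTorusInitial
import Summits.ValiantsHypothesis.ValiantsHypothesis.Theorems.GrenetZeonDualUnipotentThreeHalvesHeavyTopWalkLevelBound
import Summits.ValiantsHypothesis.ValiantsHypothesis.Theorems.GrenetZeonDualUnipotentThreeHalvesHeavyTopCodimOneReducible

/-!
# `GrenetZeon.DualUnipotentThreeHalves` (stmt-ValiantsHypothesis-24318), R2 heavy-top instrument —
# NIL-INDEX COSTS CODIMENSION: `Z^k = 0` on a nilpotent `V ≤ M_n(ℂ)` ⇒ `dim V ≤ C(n,2) − (n − k)`;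
# hence an IRREDUCIBLE nilpotent space of codimension one CONTAINS A REGULAR NILPOTENT

Experiment cell «val-heavytop-census» (D-0160), engine seat val-htc-eng-2 g3 (kernel-only lane).  The census's `(·,7)` row needs
`ι(7) ≤ 19`, which splits by Jordan type of a generic element of a `20`-dimensional nilpotent `V ≤ M₇(ℂ)`: type `(7)` (Theorem C(7)),
type `(6,1)` (the Q1 theorem, ✓ `HeavyTopCodimOneReducible`), nil-index `≤ 5` (a dimension bound «MMS»).  THIS FILE proves the dimension
bound in the kernel, in the general form

★ `finrank_add_le_choose_two_add` — `V ≤ M_n(ℂ)` a space of nilpotent matrices with `Z^k = 0` for all `Z ∈ V` ⇒ `dim V + n ≤ C(n,2) + k`;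

so the «MMS case» of codimension one is EMPTY (`k = n − 2` gives `dim V ≤ C(n,2) − 2`), and

★★ `exists_regular_of_irreducible_codimOne` — for `s ≥ 3`, an irreducible nilpotent `V ≤ M_{s+1}(ℂ)` of dimension `C(s+1,2) − 1` contains
`Z` with `Z^s ≠ 0` (a regular nilpotent); instance `exists_regular_seven_twenty` (`M₇`, dim `20`).  Consequently `ι(s+1) ≤ C(s+1,2) − 2`
hinges on Theorem C(s+1) ALONE («a nilpotent space of codimension one in `M_{s+1}` containing a regular nilpotent is reducible» — not ported).

Method (no MMS): degenerate `V` along the torus `ρ_a = 2^a` (✓ `HeavyTopTorusInitial`; all off-diagonal degrees `2^a − 2^b` are distinct) to a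
space `W` spanned by matrix units `E_ab`, `(a,b) ∈ S`, with the same dimension and the same vanishing powers; `W ∋ E_ab + E_ba` is impossible
(it fixes `e_a + e_b`), and `(Σ_S E_ab)^k = 0` says the digraph `S` has no `k`-edge walk; then ✓ `HeavyTopWalkLevelBound.card_add_le_choose_two_add`.

Honest framing: theorems about nilpotent matrix spaces; nothing here proves `ι(7) ≤ 19`, `HeavyTopLaw`/`HeavyTopSlowLaw`, 24318, S3 or 8062;
`VP ≠ VNP` is NOT proved.  No definitions.  [folklore / Gerstenhaber-type degeneration; this seat]
-/

noncomputable section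

-- single-conjunct layout: Sub = Summit, duplicated namespace component intended
set_option linter.dupNamespace false

namespace Summit.ValiantsHypothesis.ValiantsHypothesis.Theorems.GrenetZeon.HeavyTopIndexCodim

open Matrix
open Summit.ValiantsHypothesis.ValiantsHypothesis.Theorems.GrenetZeon.HeavyTopTorusInitial
  (exists_torus_initial_subspace pow_eq_zero_of_isNilpotent)
open Summit.ValiantsHypothesis.ValiantsHypothesis.Theorems.GrenetZeon.HeavyTopWalkLevelBound (card_add_le_choose_two_add)
open Summit.ValiantsHypothesis.ValiantsHypothesis.Theorems.GrenetZeon.HeavyTopCodimOneReducible (exists_regular_or_index_le_of_irreducible)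

/-! ## The torus `ρ_a = 2^a` separates off-diagonal positions -/

/-- `2^{a'} + 2^{b} = 2^{a} + 2^{b'}` with `b < a` forces `a' = a` and `b' = b`. [folklore] -/
theorem two_pow_add_inj_aux (a b a' b' : ℕ) (hba : b < a) (H : 2 ^ a' + 2 ^ b = 2 ^ a + 2 ^ b') : a' = a ∧ b' = b := by
  have hb : 2 ^ b < 2 ^ a := Nat.pow_lt_pow_right (by norm_num) hba
  have hb' : 2 ^ b' < 2 ^ a' := by
    by_contra h
    have := not_lt.1 h
    omega
  have hba' : b' < a' := (Nat.pow_lt_pow_iff_right (by norm_num)).1 hb'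
  have ha : a' = a := by
    by_contra hne
    rcases Nat.lt_or_gt_of_ne hne with h | h
    · -- `a' < a`: the left side is at most `2^a`
      have h1 : 2 ^ a' ≤ 2 ^ (a - 1) := Nat.pow_le_pow_right (by norm_num) (by omega)
      have h2 : 2 ^ b ≤ 2 ^ (a - 1) := Nat.pow_le_pow_right (by norm_num) (by omega)
      have h3 : 2 ^ (a - 1) + 2 ^ (a - 1) = 2 ^ a := by
        rw [← two_mul, ← pow_succ']; congr 1; omega
      have h4 : 0 < 2 ^ b' := Nat.pos_of_ne_zero (by positivity)
      omega
    · -- `a < a'`: the right side is at most `2^{a'}`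
      have h1 : 2 ^ a ≤ 2 ^ (a' - 1) := Nat.pow_le_pow_right (by norm_num) (by omega)
      have h2 : 2 ^ b' ≤ 2 ^ (a' - 1) := Nat.pow_le_pow_right (by norm_num) (by omega)
      have h3 : 2 ^ (a' - 1) + 2 ^ (a' - 1) = 2 ^ a' := by
        rw [← two_mul, ← pow_succ']; congr 1; omega
      have h4 : 0 < 2 ^ b := Nat.pos_of_ne_zero (by positivity)
      omega
  subst ha
  refine ⟨rfl, ?_⟩
  have : 2 ^ b' = 2 ^ b := by omega
  exact Nat.pow_right_injective (le_refl 2) this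

/-- **Distinct degrees.**  For `a ≠ b`: `2^{a'} − 2^{b'} = 2^{a} − 2^{b}` (in `ℤ`) iff `(a', b') = (a, b)`. [folklore] -/
theorem two_pow_sub_eq_iff {n : ℕ} {a b : Fin n} (hab : a ≠ b) (a' b' : Fin n) :
    ((2 ^ (a' : ℕ) : ℕ) : ℤ) - ((2 ^ (b' : ℕ) : ℕ) : ℤ) = ((2 ^ (a : ℕ) : ℕ) : ℤ) - ((2 ^ (b : ℕ) : ℕ) : ℤ) ↔ a' = a ∧ b' = b := by
  constructor
  · intro h
    have H : 2 ^ (a' : ℕ) + 2 ^ (b : ℕ) = 2 ^ (a : ℕ) + 2 ^ (b' : ℕ) := by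
      have := h; push_cast at this; omega
    rcases Nat.lt_or_gt_of_ne (Fin.val_ne_of_ne hab) with hlt | hgt
    · -- `a < b`: apply the auxiliary lemma to `(b, a, b', a')`
      have := two_pow_add_inj_aux b a b' a' hlt (by omega)
      exact ⟨Fin.ext this.2, Fin.ext this.1⟩
    · have := two_pow_add_inj_aux a b a' b' hgt H
      exact ⟨Fin.ext this.1, Fin.ext this.2⟩
  · rintro ⟨rfl, rfl⟩; rfl

/-- `(E_ab)·v` picks the `b`-th coordinate into slot `a`. [folklore] -/
theorem single_mulVec_apply {n : ℕ} (a b : Fin n) (v : Fin n → ℂ) (x : Fin n) :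
    (Matrix.single a b (1 : ℂ) *ᵥ v) x = if x = a then v b else 0 := by
  simp only [Matrix.mulVec, dotProduct, Matrix.single_apply]
  by_cases hx : x = a
  · subst hx
    rw [if_pos rfl, Finset.sum_eq_single b (fun y _ hy => by rw [if_neg (fun h => hy h.2.symm), zero_mul]) (fun h => (h (Finset.mem_univ _)).elim)]
    simp
  · rw [if_neg hx]
    exact Finset.sum_eq_zero fun y _ => by rw [if_neg (fun h => hx h.1.symm), zero_mul]

/-- A matrix fixing a non-zero vector is not nilpotent: `Z v = v`, `v ≠ 0` ⇒ `Z^m ≠ 0`. [folklore] -/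
theorem pow_ne_zero_of_mulVec_eq_self {n : ℕ} (Z : Matrix (Fin n) (Fin n) ℂ) (v : Fin n → ℂ) (hv : v ≠ 0) (hZ : Z *ᵥ v = v) (m : ℕ) :
    Z ^ m ≠ 0 := by
  have : Z ^ m *ᵥ v = v := by
    induction m with
    | zero => simp
    | succ m ih => rw [pow_succ, ← Matrix.mulVec_mulVec, hZ, ih]
  intro h
  rw [h, Matrix.zero_mulVec] at this
  exact hv this.symm

/-! ## Monomial degeneration -/

/-- ★ **Monomial degeneration.**  A space `V ≤ M_n(ℂ)` of nilpotent matrices degenerates (torus `ρ_a = 2^a`, ✓ `HeavyTopTorusInitial`) to the span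
of a set `S` of off-diagonal matrix units with `#S = dim V`, at most one orientation per pair, and `(Σ_S E_ab)^k = 0` — stated for the `0/1`
adjacency matrix over `ℕ` — whenever `Z^k = 0` on `V`. [folklore / Gerstenhaber-type degeneration; this seat] -/
theorem exists_unit_support {n : ℕ} (V : Submodule ℂ (Matrix (Fin n) (Fin n) ℂ)) (hV : ∀ A ∈ V, IsNilpotent A) :
    ∃ S : Finset (Fin n × Fin n), S.card = Module.finrank ℂ V ∧ (∀ a b : Fin n, (a, b) ∈ S → (b, a) ∉ S) ∧
      ∀ k : ℕ, (∀ A ∈ V, A ^ k = 0) → (Matrix.of fun a b : Fin n => if (a, b) ∈ S then (1 : ℕ) else 0) ^ k = 0 := by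
  classical
  set ρ : Fin n → ℕ := fun a => 2 ^ (a : ℕ) with hρ
  obtain ⟨W, hfin, hgr, -, -, hpow⟩ := exists_torus_initial_subspace ρ V
  have hWn : ∀ A ∈ W, A ^ n = 0 := hpow n fun A hA => pow_eq_zero_of_isNilpotent A (hV A hA)
  -- off-diagonal components are single entries
  have hproj : ∀ Z : Matrix (Fin n) (Fin n) ℂ, ∀ a b : Fin n, a ≠ b →
      (Matrix.of fun x y : Fin n => if (ρ x : ℤ) - ρ y = (ρ a : ℤ) - ρ b then Z x y else 0) = Z a b • Matrix.single a b (1 : ℂ) := by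
    intro Z a b hab
    ext x y
    simp only [hρ, Matrix.of_apply, Matrix.smul_apply, Matrix.single_apply, smul_eq_mul]
    by_cases h : x = a ∧ y = b
    · rw [if_pos ((two_pow_sub_eq_iff hab x y).2 h), if_pos ⟨h.1.symm, h.2.symm⟩, h.1, h.2, mul_one]
    · rw [if_neg (fun h' => h ((two_pow_sub_eq_iff hab x y).1 h')), if_neg (fun h' => h ⟨h'.1.symm, h'.2.symm⟩), mul_zero]
  have hunit : ∀ Z ∈ W, ∀ a b : Fin n, a ≠ b → Z a b ≠ 0 → Matrix.single a b (1 : ℂ) ∈ W := by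
    intro Z hZ a b hab hZab
    have h := hgr Z hZ ((ρ a : ℤ) - ρ b)
    rw [hproj Z a b hab] at h
    have := W.smul_mem (Z a b)⁻¹ h
    rwa [smul_smul, inv_mul_cancel₀ hZab, one_smul] at this
  -- diagonal entries vanish
  have hdiag : ∀ Z ∈ W, ∀ a : Fin n, Z a a = 0 := by
    intro Z hZ a
    have h := hgr Z hZ 0
    have hD : (Matrix.of fun x y : Fin n => if (ρ x : ℤ) - ρ y = 0 then Z x y else 0) = Matrix.diagonal fun x => Z x x := by
      ext x y
      simp only [hρ, Matrix.of_apply, Matrix.diagonal_apply]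
      by_cases hxy : x = y
      · subst hxy; simp
      · rw [if_neg hxy, if_neg]
        intro h0
        have : (2 : ℕ) ^ (x : ℕ) = 2 ^ (y : ℕ) := by have := h0; push_cast at this; exact_mod_cast (sub_eq_zero.1 this)
        exact hxy (Fin.ext (Nat.pow_right_injective (le_refl 2) this))
    rw [hD] at h
    have hn := hWn _ h
    rw [Matrix.diagonal_pow, Matrix.diagonal_eq_zero] at hn
    have := congrFun hn a
    simp only [Pi.pow_apply, Pi.zero_apply] at this
    exact pow_eq_zero_iff' |>.1 this |>.1
  -- the support
  set S : Finset (Fin n × Fin n) :=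
    (Finset.univ : Finset (Fin n × Fin n)).filter (fun p => p.1 ≠ p.2 ∧ Matrix.single p.1 p.2 (1 : ℂ) ∈ W) with hS
  have hmemS : ∀ a b : Fin n, (a, b) ∈ S ↔ a ≠ b ∧ Matrix.single a b (1 : ℂ) ∈ W := fun a b => by simp [hS]
  -- every `Z ∈ W` is the combination of the units in `S`
  have hexp : ∀ Z ∈ W, Z = ∑ p ∈ S, Z p.1 p.2 • Matrix.single p.1 p.2 (1 : ℂ) := by
    intro Z hZ
    ext x y
    rw [Matrix.sum_apply]
    simp only [Matrix.smul_apply, Matrix.single_apply, smul_eq_mul, mul_ite, mul_one, mul_zero]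
    rw [Finset.sum_ite, Finset.sum_const_zero, add_zero]
    have hfilter : S.filter (fun p : Fin n × Fin n => p.1 = x ∧ p.2 = y) = if (x, y) ∈ S then {(x, y)} else ∅ := by
      ext ⟨p, q⟩
      simp only [Finset.mem_filter]
      split_ifs with h
      · simp only [Finset.mem_singleton, Prod.mk.injEq]
        constructor
        · rintro ⟨_, rfl, rfl⟩; exact ⟨rfl, rfl⟩
        · rintro ⟨rfl, rfl⟩; exact ⟨h, rfl, rfl⟩
      · simp only [Finset.notMem_empty, iff_false, not_and]
        rintro hp rfl rfl; exact (h hp).elim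
    rw [hfilter]
    split_ifs with h
    · simp
    · rw [Finset.sum_empty]
      by_cases hxy : x = y
      · subst hxy; exact hdiag Z hZ x
      · by_contra hne
        exact h ((hmemS x y).2 ⟨hxy, hunit Z hZ x y hxy hne⟩)
  -- `W` is the span of the units in `S`, so `dim W = #S`
  have hli : LinearIndependent ℂ (fun p : S => Matrix.single p.1.1 p.1.2 (1 : ℂ)) := by
    have h := (Matrix.stdBasis ℂ (Fin n) (Fin n)).linearIndependent.comp (Subtype.val : S → Fin n × Fin n) Subtype.val_injective
    convert h using 1
    ext p : 1
    obtain ⟨⟨i, j⟩, hp⟩ := p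
    exact (Matrix.stdBasis_eq_single (R := ℂ) i j).symm
  have hspan : W = Submodule.span ℂ (Set.range fun p : S => Matrix.single p.1.1 p.1.2 (1 : ℂ)) := by
    apply le_antisymm
    · intro Z hZ
      rw [hexp Z hZ]
      refine Submodule.sum_mem _ fun p hp => Submodule.smul_mem _ _ (Submodule.subset_span ⟨⟨p, hp⟩, rfl⟩)
    · rw [Submodule.span_le]
      rintro _ ⟨p, rfl⟩
      exact ((hmemS p.1.1 p.1.2).1 p.2).2
  have hcard : S.card = Module.finrank ℂ V := by
    rw [← hfin, hspan, finrank_span_eq_card hli, Fintype.card_coe]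
  refine ⟨S, hcard, fun a b hab hba => ?_, fun k hk => ?_⟩
  · -- two orientations: `E_ab + E_ba` fixes `e_a + e_b`
    have hab' : a ≠ b := ((hmemS a b).1 hab).1
    have hmem : Matrix.single a b (1 : ℂ) + Matrix.single b a (1 : ℂ) ∈ W := W.add_mem ((hmemS a b).1 hab).2 ((hmemS b a).1 hba).2
    refine pow_ne_zero_of_mulVec_eq_self _ (Pi.single a (1 : ℂ) + Pi.single b 1) ?_ ?_ n (hWn _ hmem)
    · intro h
      have := congrFun h a
      simp [hab'] at this
    · ext x
      rw [Matrix.add_mulVec, Pi.add_apply, single_mulVec_apply, single_mulVec_apply]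
      by_cases hxa : x = a
      · subst hxa; simp [hab']
      · by_cases hxb : x = b
        · subst hxb; simp [hab', hxa]
        · simp [hxa, hxb]
  · -- vanishing powers transport to the adjacency matrix over `ℕ`
    have hN : (∑ p ∈ S, Matrix.single p.1 p.2 (1 : ℂ)) ∈ W :=
      Submodule.sum_mem _ fun p hp => ((hmemS p.1 p.2).1 hp).2
    have hNk : (∑ p ∈ S, Matrix.single p.1 p.2 (1 : ℂ)) ^ k = 0 := hpow k hk _ hN
    have hNM : (∑ p ∈ S, Matrix.single p.1 p.2 (1 : ℂ)) =
        (Matrix.of fun a b : Fin n => if (a, b) ∈ S then (1 : ℕ) else 0).map (Nat.castRingHom ℂ) := by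
      ext x y
      rw [Matrix.sum_apply, Matrix.map_apply, Matrix.of_apply]
      simp only [Matrix.single_apply]
      rw [Finset.sum_ite, Finset.sum_const_zero, add_zero, Finset.sum_const, nsmul_eq_mul, mul_one]
      have hfilter : S.filter (fun p : Fin n × Fin n => p.1 = x ∧ p.2 = y) = if (x, y) ∈ S then {(x, y)} else ∅ := by
        ext ⟨p, q⟩
        simp only [Finset.mem_filter]
        split_ifs with h
        · simp only [Finset.mem_singleton, Prod.mk.injEq]
          constructor
          · rintro ⟨_, rfl, rfl⟩; exact ⟨rfl, rfl⟩
          · rintro ⟨rfl, rfl⟩; exact ⟨h, rfl, rfl⟩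
        · simp only [Finset.notMem_empty, iff_false, not_and]
          rintro hp rfl rfl; exact (h hp).elim
      rw [hfilter]
      split_ifs <;> simp
    rw [hNM, ← Matrix.map_pow] at hNk
    have h0 : ((Matrix.of fun a b : Fin n => if (a, b) ∈ S then (1 : ℕ) else 0) ^ k).map (Nat.castRingHom ℂ) =
        (0 : Matrix (Fin n) (Fin n) ℕ).map (Nat.castRingHom ℂ) := by rw [hNk]; simp
    exact Matrix.map_injective (f := (Nat.castRingHom ℂ : ℕ → ℂ)) Nat.cast_injective h0

/-! ## The dimension bound and the regular element -/

/-- ★ **Nil-index costs codimension.**  `V ≤ M_n(ℂ)` a space of nilpotent matrices with `Z^k = 0` on `V` ⇒ `dim V + n ≤ C(n,2) + k`,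
i.e. `dim V ≤ C(n,2) − (n − k)`.  (`k = n`: Gerstenhaber's bound; `k = n − 1`: a nilpotent space without regular nilpotents has codimension
`≥ 1` in Gerstenhaber's bound; `k = n − 2`: codimension `≥ 2`.) [this seat] -/
theorem finrank_add_le_choose_two_add {n : ℕ} (V : Submodule ℂ (Matrix (Fin n) (Fin n) ℂ)) (hV : ∀ A ∈ V, IsNilpotent A) (k : ℕ)
    (hk : ∀ A ∈ V, A ^ k = 0) : Module.finrank ℂ V + n ≤ n.choose 2 + k := by
  obtain ⟨S, hcard, hanti, hpow⟩ := exists_unit_support V hV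
  rw [← hcard]
  exact card_add_le_choose_two_add S hanti k (hpow k hk)

/-- **Codimension two below index `n − 1`.**  `2 ≤ n`, `Z^{n−2} = 0` on a nilpotent `V ≤ M_n(ℂ)` ⇒ `dim V ≤ C(n,2) − 2` — the «MMS case» of a
codimension-one space is empty. [this seat] -/
theorem finrank_le_choose_two_sub_two {n : ℕ} (hn : 2 ≤ n) (V : Submodule ℂ (Matrix (Fin n) (Fin n) ℂ)) (hV : ∀ A ∈ V, IsNilpotent A)
    (hk : ∀ A ∈ V, A ^ (n - 2) = 0) : Module.finrank ℂ V ≤ n.choose 2 - 2 := by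
  have := finrank_add_le_choose_two_add V hV (n - 2) hk
  omega

/-- ★★ **An irreducible nilpotent space of codimension one contains a regular nilpotent.**  For `s ≥ 3`: `V ≤ M_{s+1}(ℂ)` nilpotent, irreducible,
`dim V = C(s+1,2) − 1` ⇒ some `Z ∈ V` has `Z^s ≠ 0`.  (Q1 theorem ✓ `HeavyTopCodimOneReducible` excludes type `(s,1)`; the dimension bound excludes
nil-index `≤ s − 1`.)  So `ι(s+1) ≤ C(s+1,2) − 2` is equivalent to Theorem C(s+1) (not ported). [this cell] -/
theorem exists_regular_of_irreducible_codimOne {s : ℕ} (hs : 3 ≤ s) (V : Submodule ℂ (Matrix (Fin (s + 1)) (Fin (s + 1)) ℂ))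
    (hV : ∀ A ∈ V, IsNilpotent A) (hdim : Module.finrank ℂ V = (s + 1).choose 2 - 1)
    (hirr : ∀ U : Submodule ℂ (Fin (s + 1) → ℂ), (∀ Z ∈ V, ∀ x ∈ U, Z *ᵥ x ∈ U) → U = ⊥ ∨ U = ⊤) :
    ∃ Z ∈ V, Z ^ s ≠ 0 := by
  rcases exists_regular_or_index_le_of_irreducible hs V hdim hirr with h | h
  · exact h
  · exfalso
    have hb := finrank_add_le_choose_two_add V hV (s - 1) h
    have hc : 1 ≤ (s + 1).choose 2 := Nat.choose_pos (by omega)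
    omega

/-- **Census instance `M₇`.**  An irreducible `20`-dimensional nilpotent subspace of `M₇(ℂ)` — the object `ι(7) ≤ 19` denies — would contain a
regular nilpotent (`Z^6 ≠ 0`): of the three cases of lead-g2's analysis only Theorem C(7) remains outside the kernel. [this cell] -/
theorem exists_regular_seven_twenty (V : Submodule ℂ (Matrix (Fin 7) (Fin 7) ℂ)) (hV : ∀ A ∈ V, IsNilpotent A)
    (hdim : Module.finrank ℂ V = 20)
    (hirr : ∀ U : Submodule ℂ (Fin 7 → ℂ), (∀ Z ∈ V, ∀ x ∈ U, Z *ᵥ x ∈ U) → U = ⊥ ∨ U = ⊤) :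
    ∃ Z ∈ V, Z ^ 6 ≠ 0 :=
  exists_regular_of_irreducible_codimOne (s := 6) (by norm_num) V hV (by rw [hdim]; decide) hirr

end Summit.ValiantsHypothesis.ValiantsHypothesis.Theorems.GrenetZeon.HeavyTopIndexCodim

end
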